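import Mathlib
import Literature.Analysis.FluidPDE.StationaryEulerRelaxationHighDim
import Literature.Analysis.FluidPDE.StationaryEulerPotentials
import Literature.Analysis.FluidPDE.StationaryEulerAlignedCubes
import Literature.Analysis.FluidPDE.StationaryEulerTorusGrid
import Literature.Analysis.FluidPDE.VectorCalculus
import Summits.AnomalousDissipation.AnomalousDissipation.Theorems.PointSinkPointFluxConeBoxIterationTools
import Summits.AnomalousDissipation.AnomalousDissipation.Theorems.PointSinkPointFluxConeWildBoxAssemblyTools
import Summits.AnomalousDissipation.AnomalousDissipation.Theorems.PointSinkPointFluxConeWildBoxSeedTools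
import Summits.AnomalousDissipation.AnomalousDissipation.Theorems.PointSinkPointFluxConeWildBoxLimitTools
import HarnessLib

/-!
# `PointFluxCone`, line `Sketch` — assembly of the wild box (`stub_wildBox`) from its tools

Helper file of the lead prover for item stmt-AnomalousDissipation-19033 (route PointSink, crux
`PointFluxCone`), line `Sketch`, stub `stub_wildBox` (`ITER → WILDBOX`).  Given
* the SEED (sub-stub `stub_wildBoxSeedTools`): a smooth compactly supported divergence-free
  `v₀` in the unit box with the energy profile `e = E₀ + ⟪v₀, x + c⟫`, `c = 3e₀`, strict
  subsolution `(v₀, 0) ∈ 𝒰_e`, the signal `S₀ = ∫ ⟪v₀, g⟫ > 0` for the test field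
  `g = ⟪v₀, x+c⟫ (x+c)/‖x+c‖²`, a smooth compactly supported `θ` with `∇θ = (x+c)/‖x+c‖²` on the
  box, and the pairing identity `⟪a, (b, 0)⟫ = ⟪vel a, b⟫`;
* the LIMIT lemma (sub-stub `stub_wildBoxLimitTools`): the a.e. limit `wl` with uniform pressure
  limit `πl` of a run of the box iteration, with `wl ∈ 𝒦` a.e., `|vel wl|² = e` a.e. on the box
  and the two weak identities;
* the ITERATION (landed stub `stub_boxIteration`),
this file proves WILDBOX: `W = vel ∘ wl`, `P = πl − |W|²/3` is a bounded, compactly supported weak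
Euler pair with explicit pressure, weakly divergence free, whose log-radial Bernoulli moment about
`−c` is `(1/6)·S₀ + O(θ + δ) ≠ 0` for the budgets `θ = S₀/2`, `δ = S₀/(8(R+1))`.
-/

noncomputable section

open scoped InnerProductSpace ContDiff ENNReal Topology
open Set Function MeasureTheory Metric Filter
open Literature.Analysis.FluidPDE Literature.Analysis.FluidPDE.StationaryEuler
open Literature.Analysis.FunctionSpaces

set_option linter.dupNamespace false

namespace Summit.AnomalousDissipation.AnomalousDissipation.Theorems

/-! ## The assembly -/

/-- **SEED → LIMIT → ITER → WILDBOX.**  With the seed `(v₀, e)`, run the box iteration with one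
test field `g = ⟪v₀, x+c⟫ (x+c)/‖x+c‖²` and budgets `θ = S₀/2`, `δ = S₀/(8(R+1))`
(`R = √ē + 9ē`), take the a.e. limit with pressure, and read off the compactly supported weak
Euler pair `W = vel ∘ wl`, `P = πl − |W|²/3` with `½|W|² + P = |W|²/6 + πl`; its log-radial
Bernoulli moment is `(1/6)(E₀·0 + S₀ + err₁) + err₂`, `|err₁| ≤ θ`, `|err₂| ≤ δR/3`, hence
`≥ S₀/24 > 0`. [cite: ChoffrutSzekelyhidi2014, §2 Step 3, Lemma 2] -/
theorem wildBox_of_tools :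
    ((∃ (v₀ : Ed (Fin 3) → Ed (Fin 3)) (B E₀ ebar S₀ : ℝ),
      ContDiff ℝ ∞ v₀ ∧ (∀ x, x ∉ box (Fin 3) → v₀ x = 0) ∧ (∀ x, ‖v₀ x‖ ≤ B) ∧ 0 < E₀ ∧ 0 < S₀ ∧
      (∀ x, 0 < E₀ + ⟪v₀ x, x + (3 : ℝ) • eb (0 : Fin 3)⟫_ℝ) ∧
      (∀ x, E₀ + ⟪v₀ x, x + (3 : ℝ) • eb (0 : Fin 3)⟫_ℝ ≤ ebar) ∧
      (∀ x, (mkSt (v₀ x) 0 : State (Fin 3)) ∈ HighDim.U (E₀ + ⟪v₀ x, x + (3 : ℝ) • eb (0 : Fin 3)⟫_ℝ)) ∧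
      ContDiff ℝ ∞ (fun x => (mkSt (v₀ x) 0 : State (Fin 3))) ∧
      (∀ x, ∑ i, pd (eb i) (fun y => vel ((mkSt (v₀ y) 0 : State (Fin 3))) i) x = 0) ∧
      (∀ x i, ∑ j, pd (eb j) (fun y => str ((mkSt (v₀ y) 0 : State (Fin 3))) i j) x = 0) ∧
      S₀ = ∫ x, ⟪v₀ x, (⟪v₀ x, x + (3 : ℝ) • eb (0 : Fin 3)⟫_ℝ / ‖x + (3 : ℝ) • eb (0 : Fin 3)‖ ^ 2) • (x + (3 : ℝ) • eb (0 : Fin 3))⟫_ℝ ∧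
      Continuous (fun x => (⟪v₀ x, x + (3 : ℝ) • eb (0 : Fin 3)⟫_ℝ / ‖x + (3 : ℝ) • eb (0 : Fin 3)‖ ^ 2) • (x + (3 : ℝ) • eb (0 : Fin 3))) ∧
      Continuous (fun x => (mkSt ((⟪v₀ x, x + (3 : ℝ) • eb (0 : Fin 3)⟫_ℝ / ‖x + (3 : ℝ) • eb (0 : Fin 3)‖ ^ 2) • (x + (3 : ℝ) • eb (0 : Fin 3))) 0 : State (Fin 3)))) ∧
    (∃ θ : Ed (Fin 3) → ℝ, ContDiff ℝ ∞ θ ∧ HasCompactSupport θ ∧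
      ∀ x ∈ box (Fin 3), gradient θ x = (‖x + (3 : ℝ) • eb (0 : Fin 3)‖ ^ 2)⁻¹ • (x + (3 : ℝ) • eb (0 : Fin 3))) ∧
    (∀ (a : State (Fin 3)) (b : Ed (Fin 3)), ⟪a, (mkSt b 0 : State (Fin 3))⟫_ℝ = ⟪vel a, b⟫_ℝ)) →
    (∀ (e : Ed (Fin 3) → ℝ) (ebar δ : ℝ) (w : ℕ → Ed (Fin 3) → State (Fin 3)) (π : ℕ → Ed (Fin 3) → ℝ),
      Continuous e → (∀ x, e x ≤ ebar) → 0 < δ →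
      (∀ k, ContDiff ℝ ∞ (w k)) → (∀ k, ContDiff ℝ ∞ (π k)) →
      (∀ k x, x ∉ box (Fin 3) → w k x = 0 ∧ π k x = 0) →
      (∀ k x, w k x ∈ HighDim.U (e x)) →
      (π 0 = fun _ => 0) → (∀ k x, |π (k + 1) x - π k x| ≤ δ / 2 ^ (k + 1)) →
      (∀ k x, ∑ i, pd (eb i) (fun y => vel (w k y) i) x = 0) →
      (∀ k x i, ∑ j, pd (eb j) (fun y => str (w k y) i j + (if i = j then π k y else 0)) x = 0) →
      (∀ η : ℝ, 0 < η → ∃ M : ℕ, ∀ n n', M ≤ n → n ≤ n' → ∫ x, ‖w n' x - w n x‖ ^ 2 < η) →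
      Tendsto (fun k => ∫ x in box (Fin 3), (e x - ‖vel (w k x)‖ ^ 2)) atTop (𝓝 0) →
      ∃ (wl : Ed (Fin 3) → State (Fin 3)) (πl : Ed (Fin 3) → ℝ) (ns : ℕ → ℕ), StrictMono ns ∧
        Measurable wl ∧ Continuous πl ∧
        (∀ x, ‖wl x‖ ≤ Real.sqrt ebar + 9 * ebar) ∧ (∀ x, |πl x| ≤ δ) ∧
        (∀ x, x ∉ box (Fin 3) → wl x = 0 ∧ πl x = 0) ∧
        (∀ᵐ x, Tendsto (fun i => w (ns i) x) atTop (𝓝 (wl x))) ∧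
        (∀ x, Tendsto (fun k => π k x) atTop (𝓝 (πl x))) ∧
        (∀ᵐ x, wl x ∈ K (‖vel (wl x)‖ ^ 2)) ∧
        (∀ᵐ x, x ∈ box (Fin 3) → ‖vel (wl x)‖ ^ 2 = e x) ∧
        (∀ θ : Ed (Fin 3) → ℝ, ContDiff ℝ ∞ θ → HasCompactSupport θ →
          ∫ x, ⟪vel (wl x), gradient θ x⟫_ℝ = 0) ∧
        (∀ Φ : Ed (Fin 3) → Ed (Fin 3), ContDiff ℝ ∞ Φ → HasCompactSupport Φ →
          ∫ x, ∑ i, ∑ j, (str (wl x) i j + (if i = j then πl x else 0)) * pd (eb j) (fun y => Φ y i) x = 0)) →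
    (∀ (e : Ed (Fin 3) → ℝ) (ebar : ℝ) (w₀ : Ed (Fin 3) → State (Fin 3)) (N : ℕ)
      (p : Fin N → Ed (Fin 3) → State (Fin 3)) (θ δ : ℝ),
      Continuous e → (∀ x, e x ≤ ebar) → ContDiff ℝ ∞ w₀ → (∀ x, x ∉ box (Fin 3) → w₀ x = 0) →
      (∀ x, w₀ x ∈ HighDim.U (e x)) →
      (∀ x, ∑ i, pd (eb i) (fun y => vel (w₀ y) i) x = 0) →
      (∀ x i, ∑ j, pd (eb j) (fun y => str (w₀ y) i j) x = 0) →
      (∀ a, Continuous (p a)) → 0 < θ → 0 < δ →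
      ∃ (w : ℕ → Ed (Fin 3) → State (Fin 3)) (π : ℕ → Ed (Fin 3) → ℝ),
        w 0 = w₀ ∧ (π 0 = fun _ => 0) ∧
        (∀ k, ContDiff ℝ ∞ (w k)) ∧ (∀ k, ContDiff ℝ ∞ (π k)) ∧
        (∀ k x, x ∉ box (Fin 3) → w k x = w₀ x ∧ π k x = 0) ∧
        (∀ k x, w k x ∈ HighDim.U (e x)) ∧
        (∀ k x, |π (k + 1) x - π k x| ≤ δ / 2 ^ (k + 1)) ∧
        (∀ k x, ∑ i, pd (eb i) (fun y => vel (w k y) i) x = 0) ∧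
        (∀ k x i, ∑ j, pd (eb j) (fun y => str (w k y) i j + (if i = j then π k y else 0)) x = 0) ∧
        (∀ η : ℝ, 0 < η → ∃ M : ℕ, ∀ n n', M ≤ n → n ≤ n' → ∫ x, ‖w n' x - w n x‖ ^ 2 < η) ∧
        Tendsto (fun k => ∫ x in box (Fin 3), (e x - ‖vel (w k x)‖ ^ 2)) atTop (𝓝 0) ∧
        (∀ a k, |∫ x, ⟪w k x - w₀ x, p a x⟫_ℝ| ≤ θ)) →
    (∃ (W : Ed (Fin 3) → Ed (Fin 3)) (P : Ed (Fin 3) → ℝ) (M : ℝ), Measurable W ∧ Measurable P ∧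
      (∀ x, ‖W x‖ ≤ M ∧ |P x| ≤ M) ∧
      (∀ x, x ∉ box (Fin 3) → W x = 0 ∧ P x = 0) ∧
      (∀ φ : Ed (Fin 3) → Ed (Fin 3), ContDiff ℝ ∞ φ → HasCompactSupport φ →
        ∫ x, (⟪W x, fderiv ℝ φ x (W x)⟫_ℝ + P x * VectorCalculus.divergence φ x) = 0) ∧
      (∀ θ : Ed (Fin 3) → ℝ, ContDiff ℝ ∞ θ → HasCompactSupport θ →
        ∫ x, ⟪W x, gradient θ x⟫_ℝ = 0) ∧
      (∫ x, (‖W x‖ ^ 2 / 2 + P x) *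
          (⟪W x, x + (3 : ℝ) • eb (0 : Fin 3)⟫_ℝ / ‖x + (3 : ℝ) • eb (0 : Fin 3)‖ ^ 2)) ≠ 0) := by
  rintro ⟨⟨v₀, B, E₀, ebar, S₀, hv₀s, hv₀0, hv₀B, hE₀, hS₀, hepos, heb, hU, hw₀s, hdiv0, hstr0,
    hS₀eq, hgc, hpc⟩, ⟨θl, hθls, hθlc, hθlg⟩, hinner⟩ hLim hIter
  -- the seed data
  set c : Ed (Fin 3) := (3 : ℝ) • eb (0 : Fin 3) with hc
  set e : Ed (Fin 3) → ℝ := fun x => E₀ + ⟪v₀ x, x + c⟫_ℝ with he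
  set w₀ : Ed (Fin 3) → State (Fin 3) := fun x => mkSt (v₀ x) 0 with hw₀
  set g : Ed (Fin 3) → Ed (Fin 3) := fun x => (⟪v₀ x, x + c⟫_ℝ / ‖x + c‖ ^ 2) • (x + c) with hg
  set p : Fin 1 → Ed (Fin 3) → State (Fin 3) := fun _ x => mkSt (g x) 0 with hp
  set R : ℝ := Real.sqrt ebar + 9 * ebar with hR
  obtain ⟨x0⟩ : Nonempty (Ed (Fin 3)) := inferInstance
  have hebar : 0 < ebar := (hepos x0).trans_le (heb x0)
  have hR0 : 0 ≤ R := by positivity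
  set θ : ℝ := S₀ / 2 with hθ
  set δ : ℝ := S₀ / (8 * (R + 1)) with hδ
  have hθ0 : 0 < θ := by positivity
  have hδ0 : 0 < δ := by positivity
  -- hypotheses of the iteration
  have hec : Continuous e :=
    continuous_const.add (Continuous.inner hv₀s.continuous (continuous_id.add continuous_const))
  have hw₀0 : ∀ x, x ∉ box (Fin 3) → w₀ x = 0 := fun x hx => by
    simp only [hw₀, hv₀0 x hx]; exact wildBox_mkSt_zero
  have hpcont : ∀ a, Continuous (p a) := fun _ => hpc
  -- run the iteration and take the limit
  obtain ⟨w, π, hw0, hπ0, hws, hπs, hoff, hwU, hπincr, hwdiv, hwstr, hcauchy, hdefect, horth⟩ :=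
    hIter e ebar w₀ 1 p θ δ hec heb hw₀s hw₀0 hU hdiv0 hstr0 hpcont hθ0 hδ0
  have hoff' : ∀ k x, x ∉ box (Fin 3) → w k x = 0 ∧ π k x = 0 := fun k x hx =>
    ⟨(hoff k x hx).1.trans (hw₀0 x hx), (hoff k x hx).2⟩
  obtain ⟨wl, πl, ns, hns, hwlm, hπlc, hwlR, hπlδ, hloff, hae, hπlim, hK, hvel, hdivl, hstrl⟩ :=
    hLim e ebar δ w π hec heb hδ0 hws hπs hoff' hwU hπ0 hπincr hwdiv hwstr hcauchy hdefect
  -- the weak Euler pair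
  have hWle : ∀ x, ‖vel (wl x)‖ ≤ R := fun x => (norm_vel_le _).trans (hwlR x)
  refine ⟨fun x => vel (wl x), fun x => πl x - ‖vel (wl x)‖ ^ 2 / 3, R + (δ + R ^ 2),
    continuous_vel.measurable.comp hwlm, ?_, fun x => ⟨?_, ?_⟩, fun x hx => ?_, ?_, hdivl, ?_⟩
  · exact hπlc.measurable.sub (((continuous_norm.comp continuous_vel).measurable.comp hwlm).pow_const 2
      |>.div_const 3)
  · have : 0 ≤ δ + R ^ 2 := by positivity
    linarith [hWle x]
  · rw [abs_le]
    have h1 := abs_le.1 (hπlδ x)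
    have h2 : ‖vel (wl x)‖ ^ 2 ≤ R ^ 2 := pow_le_pow_left₀ (norm_nonneg _) (hWle x) 2
    have h3 : 0 ≤ ‖vel (wl x)‖ ^ 2 := sq_nonneg _
    constructor <;> nlinarith
  · simp only [(hloff x hx).1, (hloff x hx).2, vel_zero, norm_zero]; norm_num
  · -- weak Euler with pressure
    intro φ hφ hφc
    have hae_eq : (fun x => ⟪vel (wl x), fderiv ℝ φ x (vel (wl x))⟫_ℝ +
        (πl x - ‖vel (wl x)‖ ^ 2 / 3) * VectorCalculus.divergence φ x) =ᵐ[volume]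
        fun x => ∑ i, ∑ j, (str (wl x) i j + (if i = j then πl x else 0)) * pd (eb j) (fun y => φ y i) x := by
      filter_upwards [hK] with x hx
      exact wildBox_pointwise_euler hx ((hφ.differentiable (by simp)).differentiableAt) (πl x)
    rw [integral_congr_ae hae_eq]
    exact hstrl φ hφ hφc
  · -- the moment
    -- names
    have hvol : volume (box (Fin 3)) < ⊤ := by rw [volume_box]; exact ENNReal.one_lt_top
    have hvolr : volume.real (box (Fin 3)) = 1 := by rw [measureReal_def, volume_box, ENNReal.toReal_one]
    have hW0 : ∀ x, x ∉ box (Fin 3) → vel (wl x) = 0 := fun x hx => by rw [(hloff x hx).1, vel_zero]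
    have hWm : Measurable fun x => vel (wl x) := continuous_vel.measurable.comp hwlm
    set sc : Ed (Fin 3) → ℝ := fun x => ⟪vel (wl x), x + c⟫_ℝ / ‖x + c‖ ^ 2 with hsc
    have hscm : Measurable sc :=
      (hWm.inner (continuous_id.add continuous_const).measurable).div
        ((continuous_norm.comp (continuous_id.add continuous_const)).measurable.pow_const 2)
    have hsc0 : ∀ x, x ∉ box (Fin 3) → sc x = 0 := fun x hx => by
      simp only [hsc, hW0 x hx, inner_zero_left, zero_div]
    have hscle : ∀ x, |sc x| ≤ R / 3 := by
      intro x
      by_cases hx : x ∈ box (Fin 3)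
      · have h3 := wildBox_three_le_norm_add hx
        have hpos : 0 < ‖x + c‖ := by linarith
        rw [hsc, abs_div, abs_of_pos (pow_pos hpos 2)]
        calc |⟪vel (wl x), x + c⟫_ℝ| / ‖x + c‖ ^ 2 ≤ ‖vel (wl x)‖ * ‖x + c‖ / ‖x + c‖ ^ 2 := by
              gcongr; exact abs_real_inner_le_norm _ _
          _ = ‖vel (wl x)‖ / ‖x + c‖ := by field_simp
          _ ≤ R / 3 := by
              rw [div_le_div_iff₀ hpos (by norm_num)]
              nlinarith [hWle x, norm_nonneg (vel (wl x))]
      · rw [hsc0 x hx, abs_zero]; positivity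
    -- the velocity test field `g` and its properties
    have hg0 : ∀ x, x ∉ box (Fin 3) → g x = 0 := fun x hx => by
      simp only [hg, hv₀0 x hx, inner_zero_left, zero_div, zero_smul]
    obtain ⟨G, hG⟩ : ∃ G, ∀ x, ‖g x‖ ≤ G := by
      obtain ⟨G, hG⟩ := (hgc.norm).bddAbove_range_of_hasCompactSupport
        ((HasCompactSupport.intro (isCompact_closedBall _ _) fun x hx =>
          hg0 x fun hb => hx (boxIter_box_subset_closedBall hb)).norm)
      exact ⟨G, fun x => hG ⟨x, rfl⟩⟩
    have hgi : Integrable g := boxIter_integrable hgc hg0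
    -- (1) split the integrand
    have hsplit : ∀ x, (‖vel (wl x)‖ ^ 2 / 2 + (πl x - ‖vel (wl x)‖ ^ 2 / 3)) *
        (⟪vel (wl x), x + c⟫_ℝ / ‖x + c‖ ^ 2) =
        ‖vel (wl x)‖ ^ 2 / 6 * sc x + πl x * sc x := fun x => by simp only [hsc]; ring
    have hA_int : Integrable fun x => ‖vel (wl x)‖ ^ 2 / 6 * sc x := by
      refine wildBox_integrable_of_bdd (C := R ^ 2 / 6 * (R / 3)) ?_ (fun x => ?_) fun x hx => by
        rw [hsc0 x hx, mul_zero]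
      · exact (((continuous_norm.measurable.comp hWm).pow_const 2).div_const 6 |>.mul hscm).aestronglyMeasurable
      · rw [Real.norm_eq_abs, abs_mul, abs_of_nonneg (by positivity)]
        exact mul_le_mul (by gcongr; exact hWle x) (hscle x) (abs_nonneg _) (by positivity)
    have hB_int : Integrable fun x => πl x * sc x := by
      refine wildBox_integrable_of_bdd (C := δ * (R / 3)) ?_ (fun x => ?_) fun x hx => by
        rw [hsc0 x hx, mul_zero]
      · exact (hπlc.measurable.mul hscm).aestronglyMeasurable
      · rw [Real.norm_eq_abs, abs_mul]
        exact mul_le_mul (hπlδ x) (hscle x) (abs_nonneg _) hδ0.le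
    -- (2) on the box `|W|² = e` a.e., so the first term is `(e/6)·sc = (E₀/6) sc + (1/6)⟪W, g⟫`
    have hA_ae : (fun x => ‖vel (wl x)‖ ^ 2 / 6 * sc x) =ᵐ[volume]
        fun x => E₀ / 6 * sc x + (1 / 6) * ⟪vel (wl x), g x⟫_ℝ := by
      filter_upwards [hvel] with x hx
      by_cases hb : x ∈ box (Fin 3)
      · have hWg : ⟪vel (wl x), g x⟫_ℝ = ⟪v₀ x, x + c⟫_ℝ * sc x := by
          simp only [hg, hsc, inner_smul_right]; ring
        rw [hx hb, hWg, he]; ring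
      · simp only [hsc0 x hb, hg0 x hb, mul_zero, inner_zero_right, add_zero]
    -- (3) `∫ sc = 0`: `sc = ⟪W, ∇θ⟫` and `W` is weakly divergence free
    have hsc_int0 : ∫ x, sc x = 0 := by
      have hθg : ∀ x, sc x = ⟪vel (wl x), gradient θl x⟫_ℝ := by
        intro x
        by_cases hb : x ∈ box (Fin 3)
        · rw [hθlg x hb, inner_smul_right, hsc]; ring
        · rw [hsc0 x hb, hW0 x hb, inner_zero_left]
      simp_rw [hθg]
      exact hdivl θl hθls hθlc
    -- (4) the near-orthogonality estimate passes to the limit: `|∫⟪W − v₀, g⟫| ≤ θ`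
    have horth' : ∀ k, |∫ x, ⟪vel (w k x) - v₀ x, g x⟫_ℝ| ≤ θ := by
      intro k
      have h := horth 0 k
      have hfun : (fun x => ⟪w k x - w₀ x, p 0 x⟫_ℝ) = fun x => ⟪vel (w k x) - v₀ x, g x⟫_ℝ := by
        funext x; rw [hp, hinner, vel_sub, hw₀]; simp only [vel_mkSt]
      rwa [hfun] at h
    have hwkR : ∀ k x, ‖vel (w k x)‖ ≤ R := fun k x => by
      have h := boxIter_norm_le_of_mem_U (heb x) (hwU k x)
      have : Real.sqrt ebar + 3 * ebar * 3 = R := by rw [hR]; ring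
      exact (norm_vel_le _).trans (h.trans_eq this)
    have hlim : Tendsto (fun i => ∫ x, ⟪vel (w (ns i) x) - v₀ x, g x⟫_ℝ) atTop
        (𝓝 (∫ x, ⟪vel (wl x) - v₀ x, g x⟫_ℝ)) := by
      refine tendsto_integral_of_dominated_convergence (fun x => (R + B) * ‖g x‖) (fun i => ?_)
        (hgi.norm.const_mul _) (fun i => Eventually.of_forall fun x => ?_) ?_
      · exact ((continuous_vel.comp (hws _).continuous).sub hv₀s.continuous).inner hgc
          |>.aestronglyMeasurable
      · refine (abs_real_inner_le_norm _ _).trans (mul_le_mul_of_nonneg_right ?_ (norm_nonneg _))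
        exact (norm_sub_le _ _).trans (add_le_add (hwkR _ x) (hv₀B x))
      · filter_upwards [hae] with x hx
        exact (((continuous_vel.tendsto _).comp hx).sub tendsto_const_nhds).inner tendsto_const_nhds
    have herr₁ : |∫ x, ⟪vel (wl x) - v₀ x, g x⟫_ℝ| ≤ θ :=
      le_of_tendsto' ((continuous_abs.tendsto _).comp hlim) fun i => horth' (ns i)
    -- (5) `∫⟪W, g⟫ = S₀ + ∫⟪W − v₀, g⟫`
    have hv₀g_int : Integrable fun x => ⟪v₀ x, g x⟫_ℝ :=
      boxIter_integrable (hv₀s.continuous.inner hgc) fun x hx => by rw [hg0 x hx, inner_zero_right]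
    have hWg_int : Integrable fun x => ⟪vel (wl x), g x⟫_ℝ := by
      refine wildBox_integrable_of_bdd (C := R * G) (hWm.inner hgc.measurable).aestronglyMeasurable
        (fun x => ?_) fun x hx => by rw [hg0 x hx, inner_zero_right]
      rw [Real.norm_eq_abs]
      exact (abs_real_inner_le_norm _ _).trans (mul_le_mul (hWle x) (hG x) (norm_nonneg _) hR0)
    have hWg_eq : ∫ x, ⟪vel (wl x), g x⟫_ℝ = S₀ + ∫ x, ⟪vel (wl x) - v₀ x, g x⟫_ℝ := by
      have : (fun x => ⟪vel (wl x), g x⟫_ℝ) = fun x => ⟪v₀ x, g x⟫_ℝ + ⟪vel (wl x) - v₀ x, g x⟫_ℝ := by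
        funext x; rw [← inner_add_left, add_sub_cancel]
      rw [this, integral_add hv₀g_int (hWg_int.sub hv₀g_int |>.congr ?_), ← hS₀eq]
      exact Eventually.of_forall fun x => by simp only [Pi.sub_apply, inner_sub_left]
    -- (6) the pressure term is small: `|∫ πl sc| ≤ δ R / 3`
    have herr₂ : |∫ x, πl x * sc x| ≤ δ * (R / 3) := by
      rw [← setIntegral_eq_integral_of_forall_compl_eq_zero (s := box (Fin 3))
        (fun x hx => by rw [hsc0 x hx, mul_zero]), ← Real.norm_eq_abs]
      have h := norm_setIntegral_le_of_norm_le_const hvol (f := fun x => πl x * sc x)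
        (C := δ * (R / 3)) fun x _ => by
          rw [Real.norm_eq_abs, abs_mul]
          exact mul_le_mul (hπlδ x) (hscle x) (abs_nonneg _) hδ0.le
      rwa [hvolr, mul_one] at h
    -- (7) assemble
    have htotal : ∫ x, (‖vel (wl x)‖ ^ 2 / 2 + (πl x - ‖vel (wl x)‖ ^ 2 / 3)) *
        (⟪vel (wl x), x + c⟫_ℝ / ‖x + c‖ ^ 2) =
        (1 / 6) * (S₀ + ∫ x, ⟪vel (wl x) - v₀ x, g x⟫_ℝ) + ∫ x, πl x * sc x := by
      simp_rw [hsplit]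
      rw [integral_add hA_int hB_int, integral_congr_ae hA_ae,
        integral_add ((wildBox_integrable_of_bdd hscm.aestronglyMeasurable (fun x => by
          rw [Real.norm_eq_abs]; exact hscle x) hsc0).const_mul _) (hWg_int.const_mul _),
        integral_const_mul, integral_const_mul, hsc_int0, mul_zero, zero_add, hWg_eq]
    rw [htotal]
    have hδR : δ * (R / 3) ≤ S₀ / 24 := by
      rw [hδ, div_mul_div_comm, div_le_div_iff₀ (by positivity) (by norm_num)]
      nlinarith [hS₀, hR0]
    have h1 := abs_le.1 herr₁
    have h2 := abs_le.1 herr₂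
    intro h0
    rw [hθ] at h1
    linarith [h1.1, h2.1]

/-- **Stub `stub_wildBox` of line `Sketch` (ITER → WILDBOX)**: the compactly supported wild weak
Euler pair with explicit pressure and non-zero log-radial Bernoulli moment, from the seed
(`stub_wildBoxSeedTools`), the limit lemma (`stub_wildBoxLimitTools`) and the box iteration.
[cite: ChoffrutSzekelyhidi2014, Thm. 1 (method)] -/
theorem stub_wildBox :
    (∀ (e : Ed (Fin 3) → ℝ) (ebar : ℝ) (w₀ : Ed (Fin 3) → State (Fin 3)) (N : ℕ)
      (p : Fin N → Ed (Fin 3) → State (Fin 3)) (θ δ : ℝ),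
      Continuous e → (∀ x, e x ≤ ebar) → ContDiff ℝ ∞ w₀ → (∀ x, x ∉ box (Fin 3) → w₀ x = 0) →
      (∀ x, w₀ x ∈ HighDim.U (e x)) →
      (∀ x, ∑ i, pd (eb i) (fun y => vel (w₀ y) i) x = 0) →
      (∀ x i, ∑ j, pd (eb j) (fun y => str (w₀ y) i j) x = 0) →
      (∀ a, Continuous (p a)) → 0 < θ → 0 < δ →
      ∃ (w : ℕ → Ed (Fin 3) → State (Fin 3)) (π : ℕ → Ed (Fin 3) → ℝ),
        w 0 = w₀ ∧ (π 0 = fun _ => 0) ∧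
        (∀ k, ContDiff ℝ ∞ (w k)) ∧ (∀ k, ContDiff ℝ ∞ (π k)) ∧
        (∀ k x, x ∉ box (Fin 3) → w k x = w₀ x ∧ π k x = 0) ∧
        (∀ k x, w k x ∈ HighDim.U (e x)) ∧
        (∀ k x, |π (k + 1) x - π k x| ≤ δ / 2 ^ (k + 1)) ∧
        (∀ k x, ∑ i, pd (eb i) (fun y => vel (w k y) i) x = 0) ∧
        (∀ k x i, ∑ j, pd (eb j) (fun y => str (w k y) i j + (if i = j then π k y else 0)) x = 0) ∧
        (∀ η : ℝ, 0 < η → ∃ M : ℕ, ∀ n n', M ≤ n → n ≤ n' → ∫ x, ‖w n' x - w n x‖ ^ 2 < η) ∧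
        Tendsto (fun k => ∫ x in box (Fin 3), (e x - ‖vel (w k x)‖ ^ 2)) atTop (𝓝 0) ∧
        (∀ a k, |∫ x, ⟪w k x - w₀ x, p a x⟫_ℝ| ≤ θ)) →
    (∃ (W : Ed (Fin 3) → Ed (Fin 3)) (P : Ed (Fin 3) → ℝ) (M : ℝ), Measurable W ∧ Measurable P ∧
      (∀ x, ‖W x‖ ≤ M ∧ |P x| ≤ M) ∧
      (∀ x, x ∉ box (Fin 3) → W x = 0 ∧ P x = 0) ∧
      (∀ φ : Ed (Fin 3) → Ed (Fin 3), ContDiff ℝ ∞ φ → HasCompactSupport φ →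
        ∫ x, (⟪W x, fderiv ℝ φ x (W x)⟫_ℝ + P x * VectorCalculus.divergence φ x) = 0) ∧
      (∀ θ : Ed (Fin 3) → ℝ, ContDiff ℝ ∞ θ → HasCompactSupport θ →
        ∫ x, ⟪W x, gradient θ x⟫_ℝ = 0) ∧
      (∫ x, (‖W x‖ ^ 2 / 2 + P x) *
          (⟪W x, x + (3 : ℝ) • eb (0 : Fin 3)⟫_ℝ / ‖x + (3 : ℝ) • eb (0 : Fin 3)‖ ^ 2)) ≠ 0) :=
  wildBox_of_tools stub_wildBoxSeedTools stub_wildBoxLimitTools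

end Summit.AnomalousDissipation.AnomalousDissipation.Theorems

end
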